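import Literature.IUT.LogVolume.RemarksCor23
import Literature.NumberTheory.DiophantineGeometry.GenEllThm21
import Literature.NumberTheory.DiophantineGeometry.AbcQualityProofs
import HarnessLib

/-!
# [IUTchIV] Remark 2.3.2 (ii): "the constant 1 in Corollary 2.3 cannot be improved" — PROVED

Proof-only companion of `RemarksCor23.lean` (abc-iut campaign S; statement typed by seat
abc-iut-L1-t14 as the claim-form `Rmk232.ConstantOneSharpStatement`; DAG node `IUTchIV:Rmk2.3.2(ii)`;
this proof by seat abc-iut-S-d3). Mochizuki, *Inter-universal Teichmüller theory IV*, Remark 2.3.2 (ii)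
(kurims p. 56): "the constant “1” in the inequality of the display of Corollary 2.3 cannot be improved
— cf. the examples constructed in [Mss]". The content is CLASSICAL and independent of the disputed
chain: on the `λ`-line it says that `c / rad(abc)` is unbounded over abc triples, and the elementary
family `1 + (3^{2^{k+1}} − 1) = 3^{2^{k+1}}` (Bombieri–Gubler Ex. 12.4.13; cf. Stewart–Tijdeman 1986 for
much stronger lower bounds) witnesses it: `2^{k+3} ∣ 3^{2^{k+1}} − 1`, so
`rad(abc) ≤ 3c/2^{k+2}` and `ht − (log-diff + log-cond) = log c − log rad(abc) ≥ (k+2) log 2 − log 3 → ∞`.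

* `Rmk232.two_pow_dvd_three_pow_sub_one` — `2^{k+3} ∣ 3^{2^{k+1}} − 1`;
* `Rmk232.rad_three_pow_family_le` — `rad(1·(3^{2^{k+1}}−1)·3^{2^{k+1}}) · 2^{k+2} ≤ 3·3^{2^{k+1}}`;
* `Rmk232.constantOneSharpStatement_holds : ConstantOneSharpStatement` — via the tree's [GenEll]
  dictionary for `ℚ`-points (`ratPoint_triple_mem`, `ht_ratPoint_triple`, `logDiff_ratPoint`,
  `logCond_ratPoint_triple` of `GenEllThm21.lean`).

No new definitions; `RemarksCor23.lean` is not edited.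
-/

noncomputable section

namespace Literature.IUT.LogVolume

open Literature.NumberTheory.DiophantineGeometry Literature.NumberTheory.DiophantineGeometry.GenEll
open UniqueFactorizationMonoid

namespace Rmk232

/-- `2^{k+3}` divides `3^{2^{k+1}} − 1` (induction: `3^{2^{k+2}} − 1 = (3^{2^{k+1}} − 1)(3^{2^{k+1}} + 1)`
with an even second factor; lifting-the-exponent for `p = 2`). [folklore] -/
private theorem two_pow_dvd_three_pow_sub_one (k : ℕ) : 2 ^ (k + 3) ∣ 3 ^ (2 ^ (k + 1)) - 1 := by
  induction k with
  | zero => norm_num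
  | succ k ih =>
    set a : ℕ := 3 ^ (2 ^ (k + 1)) with ha
    have hsq : 3 ^ (2 ^ (k + 1 + 1)) = a * a := by
      rw [ha, ← pow_add, ← two_mul, pow_succ, mul_comm]
    have hsplit : 3 ^ (2 ^ (k + 1 + 1)) - 1 = (a + 1) * (a - 1) := by
      rw [hsq, ← Nat.mul_self_sub_mul_self_eq a 1, mul_one]
    have heven : 2 ∣ a + 1 := by
      have hodd : Odd a := by rw [ha]; exact Odd.pow (by decide)
      exact even_iff_two_dvd.mp hodd.add_one
    rw [hsplit, show k + 1 + 3 = (k + 3) + 1 by ring, pow_succ, mul_comm (2 ^ (k + 3)) 2]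
    exact Nat.mul_dvd_mul heven ih

/-- The radical bound for the family: `rad(1 · (3^{2^{k+1}} − 1) · 3^{2^{k+1}}) · 2^{k+2} ≤ 3 · 3^{2^{k+1}}`
(the radical of `3^{2^{k+1}}` is `3`, and `2^{k+3} ∣ 3^{2^{k+1}} − 1` costs the radical of the middle term
a factor `2^{k+2}`). [folklore] -/
private theorem rad_three_pow_family_le (k : ℕ) :
    rad 1 (3 ^ (2 ^ (k + 1)) - 1) (3 ^ (2 ^ (k + 1))) * 2 ^ (k + 2) ≤ 3 * 3 ^ (2 ^ (k + 1)) := by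
  set c : ℕ := 3 ^ (2 ^ (k + 1)) with hc
  have hc9 : 9 ≤ c := by
    rw [hc]
    calc (9 : ℕ) = 3 ^ (2 ^ 1) := by norm_num
      _ ≤ 3 ^ (2 ^ (k + 1)) := Nat.pow_le_pow_right (by norm_num)
          (Nat.pow_le_pow_right (by norm_num) (by omega))
  obtain ⟨m, hm⟩ := two_pow_dvd_three_pow_sub_one k
  rw [← hc] at hm
  have hm0 : 0 < m := by
    rcases Nat.eq_zero_or_pos m with h0 | h
    · rw [h0, mul_zero] at hm; omega
    · exact h
  have hradc : radical c = 3 := by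
    rw [hc, radical_pow _ (by positivity), radical_eq_self_of_prime (by norm_num)]
  have hrad2 : radical (2 ^ (k + 3) : ℕ) = 2 := by
    rw [radical_pow _ (by omega), radical_eq_self_of_prime (by norm_num)]
  have h1 : radical (c - 1 : ℕ) ∣ 2 * m := by
    rw [hm]
    calc radical (2 ^ (k + 3) * m) ∣ radical (2 ^ (k + 3)) * radical m := radical_mul_dvd
      _ = 2 * radical m := by rw [hrad2]
      _ ∣ 2 * m := mul_dvd_mul_left 2 radical_dvd_self
  have h2 : rad 1 (c - 1) c ∣ 2 * m * 3 := by
    rw [rad_def, one_mul]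
    calc radical ((c - 1) * c) ∣ radical (c - 1) * radical c := radical_mul_dvd
      _ = radical (c - 1) * 3 := by rw [hradc]
      _ ∣ 2 * m * 3 := mul_dvd_mul_right h1 3
  have h3 : rad 1 (c - 1) c ≤ 6 * m := by
    have := Nat.le_of_dvd (by positivity) h2
    linarith
  -- `rad · 2^{k+2} ≤ 6m · 2^{k+2} = 3 · (c − 1) ≤ 3c`
  have h4 : 6 * m * 2 ^ (k + 2) = 3 * (c - 1) := by
    rw [hm, pow_succ]; ring
  calc rad 1 (c - 1) c * 2 ^ (k + 2) ≤ 6 * m * 2 ^ (k + 2) := Nat.mul_le_mul_right _ h3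
    _ = 3 * (c - 1) := h4
    _ ≤ 3 * c := Nat.mul_le_mul_left _ (Nat.sub_le _ _)

/-- The family `(1, 3^{2^{k+1}} − 1, 3^{2^{k+1}})` consists of abc triples. [folklore] -/
private theorem isABCTriple_three_pow_family (k : ℕ) :
    IsABCTriple 1 (3 ^ (2 ^ (k + 1)) - 1) (3 ^ (2 ^ (k + 1))) := by
  have hc9 : 9 ≤ 3 ^ (2 ^ (k + 1)) :=
    calc (9 : ℕ) = 3 ^ (2 ^ 1) := by norm_num
      _ ≤ 3 ^ (2 ^ (k + 1)) := Nat.pow_le_pow_right (by norm_num)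
          (Nat.pow_le_pow_right (by norm_num) (by omega))
  exact ⟨by norm_num, by omega, by omega, Nat.coprime_one_left _⟩

/-- **[IUTchIV] Remark 2.3.2 (ii)** — "the constant “1” in the inequality of the display of Corollary 2.3
cannot be improved" — PROVED in its claim-form `ConstantOneSharpStatement` (the `ε = 0` inequality
`ht_{ω_X(D)} ≲ log-diff_X + log-cond_D` FAILS on `U_X(ℚ̄)^{≤1}` for the `λ`-line): along the abc triples
`1 + (3^{2^{k+1}} − 1) = 3^{2^{k+1}}` one has `ht = log c`, `log-diff = 0`, `log-cond = log rad(abc)` and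
`log c − log rad(abc) ≥ (k+2)·log 2 − log 3 → ∞`. Classical and unconditional (Bombieri–Gubler
Ex. 12.4.13; [Mss]; Stewart–Tijdeman 1986); no side is taken on the disputed chain behind Cor. 2.3.
[cite: Mochizuki2012, IV Rmk. 2.3.2 (ii) p.56] -/
theorem constantOneSharpStatement_holds : ConstantOneSharpStatement := by
  rintro ⟨C, hC⟩
  -- choose `k` with `(k + 2)·log 2 > C + log 3`
  obtain ⟨k, hk⟩ : ∃ k : ℕ, C + Real.log 3 < ((k : ℝ) + 2) * Real.log 2 := by
    have hlog2 : 0 < Real.log 2 := Real.log_pos (by norm_num)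
    obtain ⟨k, hk⟩ := exists_nat_gt ((C + Real.log 3) / Real.log 2)
    refine ⟨k, ?_⟩
    rw [div_lt_iff₀ hlog2] at hk
    nlinarith
  set c : ℕ := 3 ^ (2 ^ (k + 1)) with hc
  have hT : IsABCTriple 1 (c - 1) c := isABCTriple_three_pow_family k
  have hc0 : 0 < c := by rw [hc]; positivity
  have hradpos : 0 < rad 1 (c - 1) c := by
    rw [rad_def]
    exact Nat.pos_of_ne_zero radical_ne_zero
  -- the dictionary at the point `λ = 1/c`
  have hmem := ratPoint_triple_mem hT
  have hht := ht_ratPoint_triple hT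
  have hdiff := logDiff_ratPoint (((1 : ℕ) : ℚ) / c)
  have hcond := logCond_ratPoint_triple hT
  have hP := hC _ hmem
  simp only at hP
  rw [hht, hdiff, hcond, zero_add] at hP
  -- the radical bound in logarithmic form: `log rad + (k+2) log 2 ≤ log 3 + log c`
  have hradle := rad_three_pow_family_le k
  rw [← hc] at hradle
  have hlogle : Real.log (rad 1 (c - 1) c) + ((k : ℝ) + 2) * Real.log 2 ≤ Real.log 3 + Real.log c := by
    have h1 : (rad 1 (c - 1) c : ℝ) * (2 : ℝ) ^ (k + 2) ≤ 3 * (c : ℝ) := by exact_mod_cast hradle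
    have h2 : Real.log ((rad 1 (c - 1) c : ℝ) * (2 : ℝ) ^ (k + 2)) ≤ Real.log (3 * (c : ℝ)) :=
      Real.log_le_log (by positivity) h1
    rw [Real.log_mul (by positivity) (by positivity), Real.log_mul (by norm_num) (by positivity),
      Real.log_pow] at h2
    push_cast at h2 ⊢
    linarith
  linarith

end Rmk232

end Literature.IUT.LogVolume

end
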